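import Summits.QuantumFields.BalabanUV.Beta.GAN24.ContactRefineP
import Summits.QuantumFields.BalabanUV.Beta.GAN24.ContactRefinePTent
import Summits.QuantumFields.BalabanUV.Beta.GAN24.ContactRefinePWeights
import Summits.QuantumFields.BalabanUV.Beta.GAN24.ContactGaugeStaircaseCauchy
import Summits.QuantumFields.BalabanUV.Beta.GAN24.ContactOneGaugeCellBound

/-!
# `BalabanUV.Beta.GAN24.ContactRefinePThree` — binder row G-an2-4 / (CONV-C), the row owner's CONTACT-TERM ROUTE, CT-4c SHAPE P at `d = 3` (road-P2 chair;
# leaf-02 g50's symmetric division W-leaf02-g50-5 «you close the P-atoms at d = 3, I close the B-atoms»): **THE P-ATOM OF THE CELLS — tent × gauge reading ×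
# gauge jump — DIFFERENCED ACROSS TWO CONSECUTIVE TOWERS, BOUNDED PARAMETRICALLY IN THE TREE's LETTERS AT ONE RATE** (leaf-12's (N1) `C`, the owner's CT-4a
# `c, θ`, d4-p3's I1 `Φ₀` + its tent, CT-4d's unit-tent difference `ε` of the pair `(k+2, k+1)`), for every in-block root, every `k`, every three source bonds
# `(μt, zt)` (tent), `(μ₁, z₁)` (read gauge), `(μ₂, z₂)` (jumping gauge), every bond reading `|θ₀| + |θ₁| ≤ 1` and every direction `κ`.

NOT IN PRINT; OUR BOOKKEEPING (road-P2 chair `b2b-balaban-gan24-p2`, gen 34; «MINE (CT-4c-P)»).  [folklore] instantiation of M4 `ContactRefineP.abs_pairing_refine_le`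
with CT-4b part 1 `ContactGaugeStaircaseCauchy` (identities `gauge_refine_eq_staircase` ∕ `gauge_coarse_eq_staircase_fine` ∕ `gauge_eq_staircase_zero`, letters
`abs_gaugePieceDiff_le` ∕ `_zero_le` ∕ `abs_gaugePieceUp_le` ∕ `abs_gaugePieceZero_le`), `ContactRefinePTent.tentDiff_letters_of_unitTent`, leaf-02's
`ContactOneGaugeCellBound.tsum_env3_le`, and the weight bounds `ContactRefinePWeights.sum_weights_spike_geometric_{left,right}_le` ∕ the owner's
`StaircasePairing.sum_weights_le_of_geometric`.  HONEST FRAMING (cell contract, verbatim): «discharging `BetaPertH` makes Bałaban's UV stability UNCONDITIONAL —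
a real constructive-QFT result; it is NOT the continuum limit and NOT the Clay problem.»  HONEST DEPENDENCY (verbatim): «continuum YM on T⁴ ⇐ BetaPertH ∧ nine
spine estimates (0/9 proved); BetaPertH ⇐ (D1) ∧ (D4) ∧ CAP+tail; G-an2-4 gates asym, D1 and NE2/3/4.»  0 `def`, 0 cited facts, 0 `def … : Prop`, 0 sorry; NO new
estimate; discharges NOTHING of hSdev by itself (the owner's CT-4e sums the atoms per cell; leaf-02's `ContactRefineBThree` is the B-atom twin); NEVER «G-an2-4
closed»; NOT (CONV-C) as typed, NOT D1, NOT BetaPertH, NOT continuum, NOT Clay.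

## What is proved (`d = 3`, `2 ≤ Lc`, in-block root; `λ′_i v := Psi ρ Lc 0 (k+1) (delta1 μ_i z_i) v − bmGaugeAt ρ (respStep 1 (Lc^(k+2)) μ_i z_i) Lc v`,
`λ_i w := Psi ρ Lc 0 k (delta1 μ_i z_i) w − bmGaugeAt ρ (respStep 1 (Lc^(k+1)) μ_i z_i) Lc w` — the cells' `respStep (Lc^0) (Lc^(0+k+1))` is this by
`ContactPartnerLetters.respStep_pow_zero`)
* **`abs_pairingAtom_refine_le`** (PARAMETRIC): `|Σ'_v 𝒬ᵀ_{Lc^(k+2)}[wΦ_{Lc^(k+2)}(·;μt;·−zt)] κ v·(θ₀λ′₁ v + θ₁λ′₁(v+e_κ))·(λ′₂(v+e_κ) − λ′₂ v)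
   − (Lc^{12})⁻¹·Σ'_w 𝒬ᵀ_{Lc^(k+1)}[wΦ_{Lc^(k+1)}(·;μt;·−zt)] κ w·(θ₀λ₁ w + θ₁λ₁(w+e_κ))·(λ₂(w+e_κ) − λ₂ w)| ≤ (B₁ + B₂)·S′ + B₃·S` with `S′, S` the two triple-envelope series and
  `B₁, B₂, B₃` DISPLAYED: `B₁ = (k+2)·2e^{2κ₀}τ′α′² + 8e^{5κ₀}·α_cθ^k·α′·Lc^{k+1}(2τ′ + Φ₀″Lc^{k+1})` (spike row + `θ^k ×` the owner's weight sum), `B₂` the mirror (spike column),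
  `B₃ = 8e^{5κ₀}α²Lc^k(2τ̃ + Φ̃Lc^k)` with `Φ̃ = ε·(Lc^4(Lc^(k+2))^8)⁻¹` (`α′ = 8LcC(Lc^{5(k+2)})⁻¹`, `α_cθ^k = 8Lc·cθ^k·(Lc^{5(k+2)})⁻¹`, `Φ₀″ = Φ₀(Lc^{8(k+2)})⁻¹`,
  `τ′ = Lc^(k+2)·Φ₀″·e^{κ₀}`, `α = 8LcC(Lc^{5(k+1)})⁻¹`, `τ̃ = Lc^(k+1)·Φ̃·e^{κ₀}`).
Unit `b2b-balaban-gan24-p2` (road-P2 chair, gen 34), 2026-08-21.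
-/

noncomputable section

open Finset
open scoped BigOperators
open Literature.MathematicalPhysics.QuantumFieldTheory
open Literature.MathematicalPhysics.QuantumFieldTheory.LatticeForm (quo)
open Literature.MathematicalPhysics.QuantumFieldTheory.Balaban1983to89
open Literature.MathematicalPhysics.QuantumFieldTheory.Balaban1983to89.Beta
open B4ContourShift (supNorm supNorm_nonneg)
open ExpKernelCalculus (Zl Zl_nonneg)
open KernelSpecInstance (wΦ)
open AffineAveraging (Form0 Form1 Site box toSite unitVec)
open AffineReproduction (contourSumAdj)
open AveragingContours (blk)
open KKTFluctuationKernel (delta1)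
open BalabanCompositeJets (respStep)
open Summit.QuantumFields.BalabanUV.Beta.AxialProjectorBlockMean (bmGaugeAt)
open Summit.QuantumFields.BalabanUV.Beta.GAN24.RespStepBmDecompLegs (legAct)
open Summit.QuantumFields.BalabanUV.Beta.GAN24.RespStepBmDecompPsi (Psi)
open Summit.QuantumFields.BalabanUV.Beta.GAN24.StaircaseFaces (blk_one)
open Summit.QuantumFields.BalabanUV.Beta.GAN24.StaircasePairing (sum_weights_le_of_geometric)
open Summit.QuantumFields.BalabanUV.Beta.GAN24.ContactOneGaugeCellBound (tsum_env3_le)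
open Summit.QuantumFields.BalabanUV.Beta.GAN24.ContactGaugeStaircaseCauchy (gauge_eq_staircase_zero gauge_refine_eq_staircase
  gauge_coarse_eq_staircase_fine abs_gaugePieceDiff_le abs_gaugePieceDiff_zero_le abs_gaugePieceUp_le abs_gaugePieceZero_le)
open Summit.QuantumFields.BalabanUV.Beta.GAN24.ContactRefineP (abs_pairing_refine_le)
open Summit.QuantumFields.BalabanUV.Beta.GAN24.ContactRefinePTent (tentDiff_letters_of_unitTent)
open Summit.QuantumFields.BalabanUV.Beta.GAN24.ContactRefinePWeights (sum_weights_spike_geometric_left_le sum_weights_spike_geometric_right_le)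

namespace Summit.QuantumFields.BalabanUV.Beta.GAN24.ContactRefinePThree

variable {Lc : ℕ} [NeZero Lc]

section Param

variable {κ₀ C c θ Φ₀ : ℝ} {rr : Fin (3 + 1) → ℕ}

/-- NOT IN PRINT; OUR BOOKKEEPING.  **THE P-ATOM DIFFERENCED ACROSS TWO TOWERS, PARAMETRIC IN THE LETTERS AT ONE RATE** (`d = 3`, `2 ≤ Lc`, in-block root; see the
module docstring for the displayed constants). -/
theorem abs_pairingAtom_refine_le (hLc : 2 ≤ Lc) (hrr : rr ∈ box (3 + 1) Lc) (hκ : 0 < κ₀) (hC : 0 ≤ C) (hc : 0 ≤ c) (hθ0 : 0 ≤ θ) (hΦ : 0 ≤ Φ₀)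
    (hN1 : ∀ (m k : ℕ) (μ : Fin (3 + 1)) (z : Site (3 + 1)) (l'' : Fin (3 + 1)) (w' : Site (3 + 1)),
      |respStep (d := 3) (Lc ^ m) (Lc ^ (m + k + 1)) μ z l'' w'| ≤
        C * ((Lc : ℝ) ^ (5 * (k + 1)))⁻¹ * Real.exp (-(κ₀ * supNorm (quo (Lc ^ (k + 1)) w' - z))))
    (hCau : ∀ (s k : ℕ) (μ : Fin (3 + 1)) (z : Site (3 + 1)) (l : Fin (3 + 1)) (w : Site (3 + 1)),
      |respStep (d := 3) (Lc ^ (s + 1)) (Lc ^ (s + k + 2)) μ z l w - respStep (d := 3) (Lc ^ s) (Lc ^ (s + k + 1)) μ z l w|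
        ≤ c * θ ^ (s + k) * ((((Lc ^ (k + 1) : ℕ) : ℝ)) ^ (3 + 2))⁻¹ * Real.exp (-(κ₀ * supNorm (quo (Lc ^ (k + 1)) w - z))))
    (hΦenv : ∀ (k : ℕ) (μ : Fin (3 + 1)) (z : Site (3 + 1)) (κ : Fin (3 + 1)) (y : Site (3 + 1)),
      |wΦ (N := Lc ^ (k + 1)) κ μ (y - z)| ≤ Φ₀ * ((Lc : ℝ) ^ (8 * (k + 1)))⁻¹ * Real.exp (-(κ₀ * supNorm (y - z))))
    (ht : ∀ (k : ℕ) (μ : Fin (3 + 1)) (z : Site (3 + 1)) (κ : Fin (3 + 1)) (u : Site (3 + 1)),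
      |contourSumAdj (Lc ^ (k + 1)) (fun κ y => wΦ (N := Lc ^ (k + 1)) κ μ (y - z)) κ u|
        ≤ (Lc ^ (k + 1) : ℕ) * (Φ₀ * ((Lc : ℝ) ^ (8 * (k + 1)))⁻¹) * Real.exp κ₀ * Real.exp (-(κ₀ * supNorm (quo (Lc ^ (k + 1)) u - z))))
    (k : ℕ) {ε : ℝ} (μt : Fin (3 + 1)) (zt : Site (3 + 1))
    (hTd : ∀ (κ' : Fin (3 + 1)) (y : Site (3 + 1)),
      |(((Lc : ℝ) ^ (k + 2)) ^ (2 * (3 + 1))) * wΦ (N := Lc ^ (k + 2)) κ' μt (y - zt)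
          - (((Lc : ℝ) ^ (k + 1)) ^ (2 * (3 + 1))) * wΦ (N := Lc ^ (k + 1)) κ' μt (y - zt)| ≤ ε * Real.exp (-(κ₀ * supNorm (y - zt))))
    (μ₁ : Fin (3 + 1)) (z₁ : Site (3 + 1)) (μ₂ : Fin (3 + 1)) (z₂ : Site (3 + 1)) {θ₀ θ₁ : ℝ} (hθr : |θ₀| + |θ₁| ≤ 1) (κ : Fin (3 + 1)) :
    |(∑' v : Site (3 + 1), contourSumAdj (Lc ^ (k + 2)) (fun κ' y => wΦ (N := Lc ^ (k + 2)) κ' μt (y - zt)) κ v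
          * (θ₀ * (Psi (toSite rr) Lc 0 (k + 1) (delta1 μ₁ z₁) v - bmGaugeAt (toSite rr) (respStep (d := 3) 1 (Lc ^ (k + 2)) μ₁ z₁) Lc v)
            + θ₁ * (Psi (toSite rr) Lc 0 (k + 1) (delta1 μ₁ z₁) (v + unitVec κ) - bmGaugeAt (toSite rr) (respStep (d := 3) 1 (Lc ^ (k + 2)) μ₁ z₁) Lc (v + unitVec κ)))
          * ((Psi (toSite rr) Lc 0 (k + 1) (delta1 μ₂ z₂) (v + unitVec κ) - bmGaugeAt (toSite rr) (respStep (d := 3) 1 (Lc ^ (k + 2)) μ₂ z₂) Lc (v + unitVec κ))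
            - (Psi (toSite rr) Lc 0 (k + 1) (delta1 μ₂ z₂) v - bmGaugeAt (toSite rr) (respStep (d := 3) 1 (Lc ^ (k + 2)) μ₂ z₂) Lc v)))
        - ((Lc : ℝ) ^ 12)⁻¹ * ∑' w : Site (3 + 1), contourSumAdj (Lc ^ (k + 1)) (fun κ' y => wΦ (N := Lc ^ (k + 1)) κ' μt (y - zt)) κ w
          * (θ₀ * (Psi (toSite rr) Lc 0 k (delta1 μ₁ z₁) w - bmGaugeAt (toSite rr) (respStep (d := 3) 1 (Lc ^ (k + 1)) μ₁ z₁) Lc w)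
            + θ₁ * (Psi (toSite rr) Lc 0 k (delta1 μ₁ z₁) (w + unitVec κ) - bmGaugeAt (toSite rr) (respStep (d := 3) 1 (Lc ^ (k + 1)) μ₁ z₁) Lc (w + unitVec κ)))
          * ((Psi (toSite rr) Lc 0 k (delta1 μ₂ z₂) (w + unitVec κ) - bmGaugeAt (toSite rr) (respStep (d := 3) 1 (Lc ^ (k + 1)) μ₂ z₂) Lc (w + unitVec κ))
            - (Psi (toSite rr) Lc 0 k (delta1 μ₂ z₂) w - bmGaugeAt (toSite rr) (respStep (d := 3) 1 (Lc ^ (k + 1)) μ₂ z₂) Lc w))|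
      ≤ ((((((k + 1 : ℕ) : ℝ)) + 1) * (2 * Real.exp (2 * κ₀) * (((Lc ^ (k + 2) : ℕ) : ℝ) * (Φ₀ * ((Lc : ℝ) ^ (8 * (k + 2)))⁻¹) * Real.exp κ₀) * (8 * (Lc : ℝ) * C * ((Lc : ℝ) ^ (5 * (k + 2)))⁻¹) * (8 * (Lc : ℝ) * C * ((Lc : ℝ) ^ (5 * (k + 2)))⁻¹))
          + 8 * Real.exp (5 * κ₀) * (8 * (Lc : ℝ) * (c * θ ^ k) * ((Lc : ℝ) ^ (5 * (k + 2)))⁻¹) * (8 * (Lc : ℝ) * C * ((Lc : ℝ) ^ (5 * (k + 2)))⁻¹) * (Lc : ℝ) ^ (k + 1) * (2 * (((Lc ^ (k + 2) : ℕ) : ℝ) * (Φ₀ * ((Lc : ℝ) ^ (8 * (k + 2)))⁻¹) * Real.exp κ₀) + (Φ₀ * ((Lc : ℝ) ^ (8 * (k + 2)))⁻¹) * (Lc : ℝ) ^ (k + 1)))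
        + (2 * Real.exp (5 * κ₀) * (8 * (Lc : ℝ) * C * ((Lc : ℝ) ^ (5 * (k + 2)))⁻¹) * (8 * (Lc : ℝ) * C * ((Lc : ℝ) ^ (5 * (k + 2)))⁻¹) * (((((k + 1 : ℕ) : ℝ)) + 1) * (((Lc ^ (k + 2) : ℕ) : ℝ) * (Φ₀ * ((Lc : ℝ) ^ (8 * (k + 2)))⁻¹) * Real.exp κ₀) + 2 * (Φ₀ * ((Lc : ℝ) ^ (8 * (k + 2)))⁻¹) * (Lc : ℝ) ^ (k + 1))
          + 8 * Real.exp (5 * κ₀) * (8 * (Lc : ℝ) * C * ((Lc : ℝ) ^ (5 * (k + 2)))⁻¹) * (8 * (Lc : ℝ) * (c * θ ^ k) * ((Lc : ℝ) ^ (5 * (k + 2)))⁻¹) * (Lc : ℝ) ^ (k + 1) * (2 * (((Lc ^ (k + 2) : ℕ) : ℝ) * (Φ₀ * ((Lc : ℝ) ^ (8 * (k + 2)))⁻¹) * Real.exp κ₀) + (Φ₀ * ((Lc : ℝ) ^ (8 * (k + 2)))⁻¹) * (Lc : ℝ) ^ (k + 1)))) *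
          (∑' v : Site (3 + 1), Real.exp (-(κ₀ * supNorm (quo (Lc ^ (k + 2)) v - zt))) * Real.exp (-(κ₀ * supNorm (quo (Lc ^ (k + 2)) v - z₁))) *
            Real.exp (-(κ₀ * supNorm (quo (Lc ^ (k + 2)) v - z₂))))
        + (8 * Real.exp (5 * κ₀) * (8 * (Lc : ℝ) * C * ((Lc : ℝ) ^ (5 * (k + 1)))⁻¹) * (8 * (Lc : ℝ) * C * ((Lc : ℝ) ^ (5 * (k + 1)))⁻¹) * (Lc : ℝ) ^ k * (2 * (((Lc ^ (k + 1) : ℕ) : ℝ) * (ε * ((Lc : ℝ) ^ 4 * ((Lc : ℝ) ^ (k + 2)) ^ 8)⁻¹) * Real.exp κ₀) + (ε * ((Lc : ℝ) ^ 4 * ((Lc : ℝ) ^ (k + 2)) ^ 8)⁻¹) * (Lc : ℝ) ^ k)) *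
          (∑' w : Site (3 + 1), Real.exp (-(κ₀ * supNorm (quo (Lc ^ (k + 1)) w - zt))) * Real.exp (-(κ₀ * supNorm (quo (Lc ^ (k + 1)) w - z₁))) *
            Real.exp (-(κ₀ * supNorm (quo (Lc ^ (k + 1)) w - z₂)))) := by
  haveI : NeZero (Lc ^ (k + 1)) := ⟨pow_ne_zero _ (NeZero.ne Lc)⟩
  haveI : NeZero (Lc ^ (k + 2)) := ⟨pow_ne_zero _ (NeZero.ne Lc)⟩
  have hL1 : 1 ≤ Lc := by omega
  have hL0 : (0 : ℝ) < (Lc : ℝ) := by exact_mod_cast (show 0 < Lc by omega)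
  have hN1' : 1 ≤ Lc ^ (k + 1) := Nat.one_le_pow _ _ (by omega)
  have hN2' : 1 ≤ Lc ^ (k + 2) := Nat.one_le_pow _ _ (by omega)
  have eN : Lc * Lc ^ (k + 1) = Lc ^ (k + 2) := by ring
  have hε : 0 ≤ ε := by
    have h := hTd 0 zt
    exact le_of_mul_le_mul_right ((zero_mul _).le.trans_eq (by ring) |>.trans ((abs_nonneg _).trans h)) (Real.exp_pos _)
  -- names of the letters
  set αP : ℝ := (8 * (Lc : ℝ) * C * ((Lc : ℝ) ^ (5 * (k + 2)))⁻¹) with hαP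
  set αCθ : ℝ := (8 * (Lc : ℝ) * (c * θ ^ k) * ((Lc : ℝ) ^ (5 * (k + 2)))⁻¹) with hαCθ
  set Φ₂ : ℝ := (Φ₀ * ((Lc : ℝ) ^ (8 * (k + 2)))⁻¹) with hΦ₂
  set τ₂ : ℝ := (((Lc ^ (k + 2) : ℕ) : ℝ) * (Φ₀ * ((Lc : ℝ) ^ (8 * (k + 2)))⁻¹) * Real.exp κ₀) with hτ₂
  set α₀ : ℝ := (8 * (Lc : ℝ) * C * ((Lc : ℝ) ^ (5 * (k + 1)))⁻¹) with hα₀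
  set Φt : ℝ := (ε * ((Lc : ℝ) ^ 4 * ((Lc : ℝ) ^ (k + 2)) ^ 8)⁻¹) with hΦt
  set τt : ℝ := (((Lc ^ (k + 1) : ℕ) : ℝ) * (ε * ((Lc : ℝ) ^ 4 * ((Lc : ℝ) ^ (k + 2)) ^ 8)⁻¹) * Real.exp κ₀) with hτt
  have hαP0 : 0 ≤ αP := by positivity
  have hαCθ0 : 0 ≤ αCθ := by positivity
  have hΦ₂0 : 0 ≤ Φ₂ := by positivity
  have hτ₂0 : 0 ≤ τ₂ := by positivity
  have hα₀0 : 0 ≤ α₀ := by positivity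
  have hΦt0 : 0 ≤ Φt := by positivity
  have hτt0 : 0 ≤ τt := by positivity
  -- the letter functions of the four fine′ staircases and the two coarse ones
  set aΔ : ℕ → ℝ := fun s => if s = 0 then αP else αCθ * (Lc : ℝ) ^ s with haΔ
  set aG : ℕ → ℝ := fun s => αP * (Lc : ℝ) ^ s with haG
  set a0 : ℕ → ℝ := fun s => α₀ * (Lc : ℝ) ^ s with ha0
  have haΔ0 : ∀ s, 0 ≤ aΔ s := fun s => by simp only [haΔ]; split_ifs <;> positivity
  have haG0 : ∀ s, 0 ≤ aG s := fun s => by positivity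
  have ha00 : ∀ s, 0 ≤ a0 s := fun s => by positivity
  have haΔL : ∀ s, aΔ s ≤ (if s = 0 then αP else 0) + αCθ * (Lc : ℝ) ^ s := by
    intro s; simp only [haΔ]; split_ifs <;> nlinarith [pow_nonneg hL0.le s, hαCθ0, hαP0]
  have haGL : ∀ s, aG s ≤ αP * (Lc : ℝ) ^ s := fun s => le_rfl
  have ha0L : ∀ s, a0 s ≤ α₀ * (Lc : ℝ) ^ s := fun s => le_rfl
  -- divisibility
  have hdvd' : ∀ s, s ≤ k + 1 → Lc ^ s ∣ Lc * Lc ^ (k + 1) := fun s hs => by rw [eN]; exact pow_dvd_pow Lc (by omega)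
  have hdvd : ∀ s, s ≤ k → Lc ^ s ∣ Lc ^ (k + 1) := fun s hs => pow_dvd_pow Lc (by omega)
  -- the quo bridge `Lc·Lc^(k+1) = Lc^(k+2)` for the fine′ envelopes
  have hq : ∀ (u' c₀ : Site (3 + 1)), Real.exp (-(κ₀ * supNorm (quo (Lc * Lc ^ (k + 1)) u' - c₀))) = Real.exp (-(κ₀ * supNorm (quo (Lc ^ (k + 2)) u' - c₀))) := by
    intro u' c₀; rw [eN]
  -- (1) tent letters of the taller tower (I1 at height k+2)
  have hφ' : ∀ (κ' : Fin (3 + 1)) (y : Site (3 + 1)),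
      |(fun κ' y => wΦ (N := Lc ^ (k + 2)) κ' μt (y - zt)) κ' y| ≤ Φ₂ * Real.exp (-(κ₀ * supNorm (y - zt))) :=
    fun κ' y => hΦenv (k + 1) μt zt κ' y
  have ht' : ∀ (κ' : Fin (3 + 1)) (u' : Site (3 + 1)),
      |contourSumAdj (Lc * Lc ^ (k + 1)) (fun κ' y => wΦ (N := Lc ^ (k + 2)) κ' μt (y - zt)) κ' u'|
        ≤ τ₂ * Real.exp (-(κ₀ * supNorm (quo (Lc * Lc ^ (k + 1)) u' - zt))) := by
    intro κ' u'
    rw [eN]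
    exact ht (k + 1) μt zt κ' u'
  -- (2) the third bracket's letters (CT-4d) and the shorter tower's tent
  obtain ⟨hφt, htt⟩ := tentDiff_letters_of_unitTent (Lc := Lc) hκ.le k μt zt hTd
  have ht0 : ∀ (κ' : Fin (3 + 1)) (w : Site (3 + 1)),
      |contourSumAdj (Lc ^ (k + 1)) (fun κ' y => wΦ (N := Lc ^ (k + 1)) κ' μt (y - zt)) κ' w|
        ≤ ((((Lc ^ (k + 1) : ℕ) : ℝ)) * (Φ₀ * ((Lc : ℝ) ^ (8 * (k + 1)))⁻¹) * Real.exp κ₀) * Real.exp (-(κ₀ * supNorm (quo (Lc ^ (k + 1)) w - zt))) :=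
    fun κ' w => ht k μt zt κ' w
  -- (3) the four fine′ staircases: identities and letters
  have hΔψ := fun (v : Site (3 + 1)) => gauge_refine_eq_staircase (Lc := Lc) (d := 3) (toSite rr) k μ₁ z₁ v
  have hΔχ := fun (v : Site (3 + 1)) => gauge_refine_eq_staircase (Lc := Lc) (d := 3) (toSite rr) k μ₂ z₂ v
  have hψup := fun (v : Site (3 + 1)) => gauge_coarse_eq_staircase_fine (Lc := Lc) (d := 3) (toSite rr) k μ₁ z₁ v
  have hχ' : ∀ v : Site (3 + 1), (Psi (toSite rr) Lc 0 (k + 1) (delta1 μ₂ z₂) v - bmGaugeAt (toSite rr) (respStep (d := 3) 1 (Lc ^ (k + 2)) μ₂ z₂) Lc v)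
      = ∑ s ∈ Finset.range (k + 2), (fun (s : ℕ) (y : Site (3 + 1)) =>
          -(((Lc : ℝ) ^ ((3 + 1) * s))⁻¹ * bmGaugeAt (toSite rr) (legAct (respStep (d := 3) (Lc ^ s) (Lc ^ (k + 2))) (delta1 μ₂ z₂)) Lc y)) s (blk (Lc ^ s) v) := by
    intro v
    have h := gauge_eq_staircase_zero (Lc := Lc) (d := 3) (toSite rr) (k + 1) μ₂ z₂ v
    rw [show k + 1 + 1 = k + 2 from rfl] at h
    exact h
  have hGΔ : ∀ (μ : Fin (3 + 1)) (z : Site (3 + 1)) (s : ℕ), s ≤ k + 1 → ∀ u' : Site (3 + 1),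
      |(fun (s' : ℕ) (y : Site (3 + 1)) =>
          if s' = 0 then -bmGaugeAt (toSite rr) (legAct (respStep (d := 3) 1 (Lc ^ (k + 2))) (delta1 μ z)) Lc y
          else -(((Lc : ℝ) ^ ((3 + 1) * s'))⁻¹ *
            bmGaugeAt (toSite rr) (legAct (respStep (d := 3) (Lc ^ s') (Lc ^ (k + 2))) (delta1 μ z)
              - legAct (respStep (d := 3) (Lc ^ (s' - 1)) (Lc ^ (k + 1))) (delta1 μ z)) Lc y)) s (blk (Lc ^ s) u')|
        ≤ aΔ s * Real.exp (-(κ₀ * supNorm (quo (Lc * Lc ^ (k + 1)) u' - z))) := by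
    intro μ z s hs u'
    rw [hq]
    rcases Nat.eq_zero_or_pos s with h0 | hpos
    · subst h0
      have h := abs_gaugePieceDiff_zero_le (Lc := Lc) hN1 hrr k μ z u'
      simp only [haΔ, if_true] at h ⊢
      exact h
    · have h := abs_gaugePieceDiff_le (Lc := Lc) hCau hrr k μ z hpos hs u'
      have hne : s ≠ 0 := by omega
      simp only [haΔ, if_neg hne] at h ⊢
      exact h
  have hGup : ∀ (μ : Fin (3 + 1)) (z : Site (3 + 1)) (s : ℕ), s ≤ k + 1 → ∀ u' : Site (3 + 1),
      |(fun (s' : ℕ) (y : Site (3 + 1)) =>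
          if s' = 0 then (0 : ℝ)
          else -(((Lc : ℝ) ^ ((3 + 1) * s'))⁻¹ *
            bmGaugeAt (toSite rr) (legAct (respStep (d := 3) (Lc ^ (s' - 1)) (Lc ^ (k + 1))) (delta1 μ z)) Lc y)) s (blk (Lc ^ s) u')|
        ≤ aG s * Real.exp (-(κ₀ * supNorm (quo (Lc * Lc ^ (k + 1)) u' - z))) := by
    intro μ z s hs u'
    rw [hq]
    exact abs_gaugePieceUp_le (Lc := Lc) hC hN1 hrr k μ z hs u'
  have hG' : ∀ (μ : Fin (3 + 1)) (z : Site (3 + 1)) (s : ℕ), s ≤ k + 1 → ∀ u' : Site (3 + 1),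
      |(fun (s : ℕ) (y : Site (3 + 1)) =>
          -(((Lc : ℝ) ^ ((3 + 1) * s))⁻¹ * bmGaugeAt (toSite rr) (legAct (respStep (d := 3) (Lc ^ s) (Lc ^ (k + 2))) (delta1 μ z)) Lc y)) s (blk (Lc ^ s) u')|
        ≤ aG s * Real.exp (-(κ₀ * supNorm (quo (Lc * Lc ^ (k + 1)) u' - z))) := by
    intro μ z s hs u'
    rw [hq]
    have h := abs_gaugePieceZero_le (Lc := Lc) hN1 hrr (k + 1) μ z hs u'
    rw [show k + 1 + 1 = k + 2 from rfl] at h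
    exact h
  -- (4) the two coarse staircases
  have hψ := fun (w : Site (3 + 1)) => gauge_eq_staircase_zero (Lc := Lc) (d := 3) (toSite rr) k μ₁ z₁ w
  have hχ := fun (w : Site (3 + 1)) => gauge_eq_staircase_zero (Lc := Lc) (d := 3) (toSite rr) k μ₂ z₂ w
  have hG : ∀ (μ : Fin (3 + 1)) (z : Site (3 + 1)) (s : ℕ), s ≤ k → ∀ w : Site (3 + 1),
      |(fun (s : ℕ) (y : Site (3 + 1)) =>
          -(((Lc : ℝ) ^ ((3 + 1) * s))⁻¹ * bmGaugeAt (toSite rr) (legAct (respStep (d := 3) (Lc ^ s) (Lc ^ (k + 1))) (delta1 μ z)) Lc y)) s (blk (Lc ^ s) w)|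
        ≤ a0 s * Real.exp (-(κ₀ * supNorm (quo (Lc ^ (k + 1)) w - z))) :=
    fun μ z s hs w => abs_gaugePieceZero_le (Lc := Lc) hN1 hrr k μ z hs w
  -- (5) the summable envelope classes
  have hE' := (tsum_env3_le (d := 3) (L := Lc * Lc ^ (k + 1)) (by rw [eN]; exact hN2') hκ zt z₁ z₂).1
  have hE := (tsum_env3_le (d := 3) (L := Lc ^ (k + 1)) hN1' hκ zt z₁ z₂).1
  -- (6) the schema
  have h := abs_pairing_refine_le (d := 3) (P := Lc) (N := Lc ^ (k + 1)) (k := k) (κ₀ := κ₀)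
    (φ' := fun κ' y => wΦ (N := Lc ^ (k + 2)) κ' μt (y - zt)) (φ := fun κ' y => wΦ (N := Lc ^ (k + 1)) κ' μt (y - zt))
    (ψ' := fun v => Psi (toSite rr) Lc 0 (k + 1) (delta1 μ₁ z₁) v - bmGaugeAt (toSite rr) (respStep (d := 3) 1 (Lc ^ (k + 2)) μ₁ z₁) Lc v)
    (χ' := fun v => Psi (toSite rr) Lc 0 (k + 1) (delta1 μ₂ z₂) v - bmGaugeAt (toSite rr) (respStep (d := 3) 1 (Lc ^ (k + 2)) μ₂ z₂) Lc v)
    (ψ := fun w => Psi (toSite rr) Lc 0 k (delta1 μ₁ z₁) w - bmGaugeAt (toSite rr) (respStep (d := 3) 1 (Lc ^ (k + 1)) μ₁ z₁) Lc w)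
    (χ := fun w => Psi (toSite rr) Lc 0 k (delta1 μ₂ z₂) w - bmGaugeAt (toSite rr) (respStep (d := 3) 1 (Lc ^ (k + 1)) μ₂ z₂) Lc w)
    (cψ := ((Lc : ℝ) ^ (3 + 1))⁻¹) (cχ := ((Lc : ℝ) ^ (3 + 1))⁻¹) (c₀ := ((Lc : ℝ) ^ 12)⁻¹)
    (ΔG₁ := (fun (s' : ℕ) (y : Site (3 + 1)) => if s' = 0 then -bmGaugeAt (toSite rr) (legAct (respStep (d := 3) 1 (Lc ^ (k + 2))) (delta1 μ₁ z₁)) Lc y else -(((Lc : ℝ) ^ ((3 + 1) * s'))⁻¹ * bmGaugeAt (toSite rr) (legAct (respStep (d := 3) (Lc ^ s') (Lc ^ (k + 2))) (delta1 μ₁ z₁) - legAct (respStep (d := 3) (Lc ^ (s' - 1)) (Lc ^ (k + 1))) (delta1 μ₁ z₁)) Lc y)))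
    (Gup₁ := (fun (s' : ℕ) (y : Site (3 + 1)) => if s' = 0 then (0 : ℝ) else -(((Lc : ℝ) ^ ((3 + 1) * s'))⁻¹ * bmGaugeAt (toSite rr) (legAct (respStep (d := 3) (Lc ^ (s' - 1)) (Lc ^ (k + 1))) (delta1 μ₁ z₁)) Lc y)))
    (G₂' := (fun (s : ℕ) (y : Site (3 + 1)) => -(((Lc : ℝ) ^ ((3 + 1) * s))⁻¹ * bmGaugeAt (toSite rr) (legAct (respStep (d := 3) (Lc ^ s) (Lc ^ (k + 2))) (delta1 μ₂ z₂)) Lc y)))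
    (ΔG₂ := (fun (s' : ℕ) (y : Site (3 + 1)) => if s' = 0 then -bmGaugeAt (toSite rr) (legAct (respStep (d := 3) 1 (Lc ^ (k + 2))) (delta1 μ₂ z₂)) Lc y else -(((Lc : ℝ) ^ ((3 + 1) * s'))⁻¹ * bmGaugeAt (toSite rr) (legAct (respStep (d := 3) (Lc ^ s') (Lc ^ (k + 2))) (delta1 μ₂ z₂) - legAct (respStep (d := 3) (Lc ^ (s' - 1)) (Lc ^ (k + 1))) (delta1 μ₂ z₂)) Lc y)))
    (G₁ := (fun (s : ℕ) (y : Site (3 + 1)) => -(((Lc : ℝ) ^ ((3 + 1) * s))⁻¹ * bmGaugeAt (toSite rr) (legAct (respStep (d := 3) (Lc ^ s) (Lc ^ (k + 1))) (delta1 μ₁ z₁)) Lc y)))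
    (G₂ := (fun (s : ℕ) (y : Site (3 + 1)) => -(((Lc : ℝ) ^ ((3 + 1) * s))⁻¹ * bmGaugeAt (toSite rr) (legAct (respStep (d := 3) (Lc ^ s) (Lc ^ (k + 1))) (delta1 μ₂ z₂)) Lc y)))
    (aΔ := aΔ) (aup := aG) (b' := aG) (bΔ := aΔ) (a := a0) (b := a0)
    hκ.le hτ₂0 hΦ₂0 (by positivity) (by positivity) hL1 hθr haΔ0 haG0 haG0 haΔ0 ha00 ha00 hdvd' hdvd hφ' ht' hφt htt ht0
    hΔψ (hGΔ μ₁ z₁) hψup (hGup μ₁ z₁) hχ' (hG' μ₂ z₂) hΔχ (hGΔ μ₂ z₂) hψ (hG μ₁ z₁) hχ (hG μ₂ z₂) hE' hE κ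
  rw [eN] at h
  refine h.trans ?_
  -- (7) the weights
  have hW1 := sum_weights_spike_geometric_left_le (K := k + 1) (Lc := Lc) (κ₀ := κ₀) (τ := τ₂) (Φ₀ := Φ₂) hκ.le hτ₂0 hΦ₂0 hLc
    hαP0 hαCθ0 hαP0 haΔ0 haG0 haΔL haGL
  have hW2 := sum_weights_spike_geometric_right_le (K := k + 1) (Lc := Lc) (κ₀ := κ₀) (τ := τ₂) (Φ₀ := Φ₂) hκ.le hτ₂0 hΦ₂0 hLc
    hαP0 hαP0 hαCθ0 haG0 haΔ0 haGL haΔL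
  have hW3 := sum_weights_le_of_geometric (k := k) (Lc := Lc) (κ₀ := κ₀) (τ := τt) (Φ₀ := Φt) hLc hκ.le hτt0 hΦt0 hα₀0 hα₀0 ha00 ha00 ha0L ha0L
  have hS'0 : 0 ≤ ∑' v : Site (3 + 1), Real.exp (-(κ₀ * supNorm (quo (Lc ^ (k + 2)) v - zt))) * Real.exp (-(κ₀ * supNorm (quo (Lc ^ (k + 2)) v - z₁))) *
      Real.exp (-(κ₀ * supNorm (quo (Lc ^ (k + 2)) v - z₂))) := tsum_nonneg fun v => by positivity
  have hS0 : 0 ≤ ∑' w : Site (3 + 1), Real.exp (-(κ₀ * supNorm (quo (Lc ^ (k + 1)) w - zt))) * Real.exp (-(κ₀ * supNorm (quo (Lc ^ (k + 1)) w - z₁))) *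
      Real.exp (-(κ₀ * supNorm (quo (Lc ^ (k + 1)) w - z₂))) := tsum_nonneg fun w => by positivity
  have e12 : (k + 1 : ℕ) + 1 = k + 2 := rfl
  rw [← add_mul]
  refine add_le_add (mul_le_mul_of_nonneg_right ?_ hS'0) (mul_le_mul_of_nonneg_right ?_ hS0)
  · exact (add_le_add hW1 hW2).trans (le_of_eq rfl)
  · exact hW3.trans (le_of_eq rfl)

end Param

end Summit.QuantumFields.BalabanUV.Beta.GAN24.ContactRefinePThree

end
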